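import Summits.ResolutionOfSingularities.ResolutionOfSingularities.Theorems.WeightedInvariantJOpenPresentationCrossingStratum
import Summits.ResolutionOfSingularities.ResolutionOfSingularities.Theorems.WeightedInvariantJOpenPresentationLE3Defs
import Summits.ResolutionOfSingularities.ResolutionOfSingularities.Theorems.WeightedInvariantJFlatEssSmoothPoint
import Summits.ResolutionOfSingularities.ResolutionOfSingularities.Theorems.WeightedInvariantJFlatEssSmoothInForm
import Summits.ResolutionOfSingularities.ResolutionOfSingularities.Theorems.WeightedInvariantJFlatEssSmoothLevels
import Summits.ResolutionOfSingularities.ResolutionOfSingularities.Theorems.WeightedInvariantContactCentreFiltrationRegular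
import Literature.AlgebraicGeometry.Resolution.StrictNormalCrossingsDescent
import Literature.AlgebraicGeometry.Resolution.StrictNormalCrossingsAt
import Literature.AlgebraicGeometry.Resolution.BlowupRingExceptionalFibre
import HarnessLib

/-!
# (open″)≤3 for the pair of record `(ι₃ᵗ, J₃ᵗ)` — THE CROSSING POINT BODY (P₁₀): `JOpenLE3.PointBodyLE3 p 1 0`
# (door `HypersurfaceCentreConstruction`, stmt-ResolutionOfSingularities-19897; P3 rung clause h8
# `JOpenPresentationForallSingLE 3 p Iota3.iotaFlatT Iota3.jFlatT`; input `hP10` of res-D-brk-1's regime assembly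
# `JOpenLE3.jOpenPresentationForallSingLE_three_of`; DEAL (o52-Bε1), res-L1-w43-plan-1 DEALER LINES #2 2026-08-27T18:06:55Z,
# hand res-L1-w43-stub-3)

Topic: `Summits/ResolutionOfSingularities/ResolutionOfSingularities/Theorems`. Helper for the door item
`HypersurfaceCentreConstruction` (stmt-ResolutionOfSingularities-19897, route `WeightedInvariant`), line `local-engine`
(L W4.3), def-free.  At a model position `(A, 𝔪, F)` of dimension `3` whose top `ι₀`-stratum is the closed point with
`(ε, τ) = (1, 0)` (CROSSING), the literal ∃-body `JOpenLE3.JOpenBodyLE3 iotaFlatT jFlatT A 𝔪 F` holds with `N = 3`,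
`U = (g, x₁, x₂)` numerators of a regular system of parameters of `A_𝔪` whose first member carries `F/1` to the terminal contact
level `B = bMax (F/1)`, and `W = (B, 1, 1)`:

* the STRATUM IFF on a basic open `D(h) ∋ 𝔪` is `CrossingPoint.exists_stratumIff_crossing` (…JOpenPresentationCrossingStratum)
  plus `(∀ i, U i ∈ 𝔮) ↔ 𝔪 ≤ 𝔮` on a basic open (`CrossingPoint.exists_not_mem_forall_le`);
* the PRESENTATION at `𝔮 = 𝔪` (the only prime of `D(h) ∩ V(U)` of local dimension `≤ 3`, `CrossingPoint.eq_of_le_of_ringKrullDim`):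
  `J₃ᵗ(A_𝔪, F) = jContact` (res-type-061's `jFlatT_eq_jContact_of_eps_eq_one`) `= contactFiltration g B` (res-type-092's
  `jContact_eq_contactFiltration`) `= F^{(B,1,1)}(g, x₁, x₂)` (res-L1-w43-stub-3's `JFlatEssSmooth.weightedIdealW_eq_contactFiltration`,
  p549593) `= weightedMonomialIdeal (g, x₁, x₂) (B, 1, 1)` (`weightedMonomialIdeal_eq_weightedIdealW`) `= (weightedMonomialIdeal U W) A_𝔪`
  (`map_weightedMonomialIdeal`).

* §1 `map_weightedMonomialIdeal`, `weightedMonomialIdeal_eq_weightedIdealW` (dictionary Wlodarczyk-style ↔ CJS-style weighted ideals).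
* §2 **`JOpenLE3.pointBodyLE3_one_zero : JOpenLE3.PointBodyLE3 p 1 0`**.

[OURS · L1 W4.3 · (o52-Bε1)]  Replaces the role of NO printed item; NOT a statement of the manuscript
[claim: Hironaka2017, status: under-review]. AI work, weaker than expert review.  Pure commutative algebra; no named facts.

## References

* H. Hironaka, *Characteristic polyhedra of singularities*, J. Math. Kyoto Univ. 7 (1967), §1 (weighted filtrations). [Hironaka1967]
* H. Matsumura, *Commutative Ring Theory* (1987), Thm. 14.2 (regular parameters), Thm. 13.5 (heights). [Matsumura1987]
* res-D-brk-1 `…JOpenPresentationLE3Defs` (p553420), res-type-061 `…P3tDrop`, res-type-092 `…ContactCentreFiltrationRegular` (OURS, AI work).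
-/

noncomputable section

open IsLocalRing Literature.AlgebraicGeometry.Resolution
open Summit.ResolutionOfSingularities.ResolutionOfSingularities.Cruxes.HypersurfaceCentreConstruction.LocalEngine
open Summit.ResolutionOfSingularities.ResolutionOfSingularities.Cruxes.HypersurfaceCentreConstruction.LocalEngine.Iota3

set_option linter.dupNamespace false -- mandated namespace of this single-conjunct summit

namespace Summit.ResolutionOfSingularities.ResolutionOfSingularities.Theorems

namespace CrossingPoint

/-! ## §1 Weighted monomial ideals: extension, and the dictionary with the weighted order ideal -/

section Dictionary

variable {A B : Type} [CommRing A] [CommRing B]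

/-- **Weighted monomial ideals extend generator by generator**: `(U; W)_m · B = (φ ∘ U; W)_m`. [folklore] -/
theorem map_weightedMonomialIdeal (φ : A →+* B) {n : ℕ} (u : Fin n → A) (w : Fin n → ℕ) (m : ℕ) :
    (weightedMonomialIdeal u w m).map φ = weightedMonomialIdeal (φ ∘ u) w m := by
  unfold weightedMonomialIdeal
  rw [Ideal.map_span]
  congr 1
  ext x
  constructor
  · rintro ⟨_, ⟨α, hα, rfl⟩, rfl⟩
    exact ⟨α, hα, by simp [map_prod, map_pow]⟩
  · rintro ⟨α, hα, rfl⟩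
    exact ⟨∏ i, u i ^ α i, ⟨α, hα, rfl⟩, by simp [map_prod, map_pow]⟩

/-- **Dictionary**: for three generators the weighted monomial ideal of the Rees-algebra calculus (`weightedMonomialIdeal`,
Włodarczyk Lemma 2.1.12) is the weighted order ideal of the initial-form calculus (`weightedIdealW`, Hironaka §1). [folklore] -/
theorem weightedMonomialIdeal_eq_weightedIdealW (c : Fin 3 → A) (w : Fin 3 → ℕ) (m : ℕ) :
    weightedMonomialIdeal c w m = weightedIdealW c w m := by
  unfold weightedMonomialIdeal weightedIdealW
  congr 1
  ext x
  have hwt : ∀ e : Fin 3 →₀ ℕ, Finsupp.weight w e = ∑ i, w i * e i := fun e => by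
    rw [Finsupp.weight_apply, Finsupp.sum_fintype _ _ (by simp)]
    simp [smul_eq_mul, mul_comm]
  have hmon : ∀ e : Fin 3 →₀ ℕ, monom3 c e = ∏ i, c i ^ e i := fun e => by
    simp [monom3, Fin.prod_univ_three]
  constructor
  · rintro ⟨α, hα, rfl⟩
    refine ⟨Finsupp.equivFunOnFinite.symm α, ?_, ?_⟩
    · rw [hwt]; simpa using hα
    · rw [hmon]; simp
  · rintro ⟨e, he, rfl⟩
    exact ⟨e, by rw [← hwt]; exact he, hmon e⟩

end Dictionary

end CrossingPoint

/-! ## §2 The crossing point body -/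

namespace JOpenLE3

/-- **THE CROSSING POINT BODY (P₁₀) of the (open″)≤3 regime assembly.**  At every model position `(A, 𝔪, F)` (`k₀` perfect of
characteristic `p`, `A` of finite type, `A_𝔪` regular of dimension `3`, `0 ≠ F/1 ∈ 𝔪² A_𝔪`) whose top `(ν ; ε ; τ)`-stratum is the
closed point, with `ε = 1` and `τ = 0`: the body `JOpenBodyLE3 iotaFlatT jFlatT A 𝔪 F` — a basic open `D(h) ∋ 𝔪`, the system
`U = (g, x₁, x₂)` (numerators of a regular system of parameters of `A_𝔪`, `g` a terminal contact parameter of `F/1`), weights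
`(bMax (F/1), 1, 1)`, the stratum iff at every prime of `D(h)` of local dimension `≤ 3` and the presentation of `J₃ᵗ = jContact` at
`𝔪`. [OURS · L1 W4.3 · (o52-Bε1)] [cite: Hironaka1967, §1] -/
theorem pointBodyLE3_one_zero (p : ℕ) : PointBodyLE3 p 1 0 := by
  intro k₀ _ _ _ A _ _ _ 𝔪 _ F hreg hdim hF0 hF2 htop hε hτ
  classical
  haveI := hreg
  haveI : IsNoetherianRing A := Algebra.FiniteType.isNoetherianRing k₀ A
  -- (1) the contact data at `S = A_𝔪`
  have hnm : ¬ IsMonomialType (algebraMap A (Localization.AtPrime 𝔪) F) :=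
    JFlatEssSmooth.not_isMonomialType_of_iotaEps_eq_one (Localization.AtPrime 𝔪) hε
  obtain ⟨hB1, g', hg', hg'2, hreach⟩ :=
    one_le_bMax_and_reaches_of_essFiniteType k₀ (Localization.AtPrime 𝔪) hF0 hF2 hnm
  have hd3 : (maximalIdeal (Localization.AtPrime 𝔪)).spanFinrank = 3 := by
    have h := IsRegularLocalRing.spanFinrank_maximalIdeal (R := Localization.AtPrime 𝔪)
    rw [hdim] at h
    exact_mod_cast h
  -- (2) a regular system `z` of `A_𝔪` through `g'`, and numerators `U` in `A`
  obtain ⟨z, hz, hz0⟩ := exists_rsop_apply_eq hd3 hg' hg'2 (0 : Fin 3)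
  have hsurj := fun i => IsLocalization.surj 𝔪.primeCompl (S := Localization.AtPrime 𝔪) (z i)
  choose nt hnt using hsurj
  let U : Fin 3 → A := fun i => (nt i).1
  have hunit : ∀ i, IsUnit (algebraMap A (Localization.AtPrime 𝔪) ((nt i).2 : A)) := fun i =>
    IsLocalization.map_units (Localization.AtPrime 𝔪) (nt i).2
  have hcU : ∀ i, algebraMap A (Localization.AtPrime 𝔪) (U i) = z i * algebraMap A (Localization.AtPrime 𝔪) ((nt i).2 : A) :=
    fun i => (hnt i).symm
  have hspanU : Ideal.span (Set.range fun i => algebraMap A (Localization.AtPrime 𝔪) (U i)) =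
      maximalIdeal (Localization.AtPrime 𝔪) := by
    rw [← hz]
    apply le_antisymm
    · rw [Ideal.span_le]
      rintro _ ⟨i, rfl⟩
      dsimp only
      rw [SetLike.mem_coe, hcU]
      exact Ideal.mul_mem_right _ _ (Ideal.subset_span ⟨i, rfl⟩)
    · rw [Ideal.span_le]
      rintro _ ⟨i, rfl⟩
      obtain ⟨v, hv⟩ := (hunit i).exists_right_inv
      have hzi : z i = algebraMap A (Localization.AtPrime 𝔪) (U i) * v := by rw [hcU, mul_assoc, hv, mul_one]
      rw [SetLike.mem_coe, hzi]
      exact Ideal.mul_mem_right _ _ (Ideal.subset_span ⟨i, rfl⟩)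
  have hUmem : ∀ i, algebraMap A (Localization.AtPrime 𝔪) (U i) ∈ maximalIdeal (Localization.AtPrime 𝔪) := fun i =>
    hspanU ▸ Ideal.subset_span ⟨i, rfl⟩
  have hUmem𝔪 : ∀ i, U i ∈ 𝔪 := fun i =>
    (IsLocalization.AtPrime.to_map_mem_maximal_iff (Localization.AtPrime 𝔪) 𝔪 (U i)).mp (hUmem i)
  have hli : LinearIndependent (ResidueField (Localization.AtPrime 𝔪))
      (fun i => (maximalIdeal (Localization.AtPrime 𝔪)).toCotangent ⟨_, hUmem i⟩) :=
    (linearIndependent_toCotangent_iff_forall_mem _ hUmem).mpr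
      (fun c hc i => mem_maximalIdeal_of_sum_mul_rsop_mem_sq hd3 _ hspanU c hc i)
  -- the first numerator is a terminal contact parameter
  have hU0sq : algebraMap A (Localization.AtPrime 𝔪) (U 0) ∉ maximalIdeal (Localization.AtPrime 𝔪) ^ 2 := by
    intro h2
    apply hg'2
    obtain ⟨v, hv⟩ := (hunit 0).exists_right_inv
    have : g' = algebraMap A (Localization.AtPrime 𝔪) (U 0) * v := by rw [hcU, hz0, mul_assoc, hv, mul_one]
    rw [this]
    exact Ideal.mul_mem_right _ _ h2
  have hcf : ∀ n, contactFiltration (algebraMap A (Localization.AtPrime 𝔪) (U 0)) (bMax (algebraMap A (Localization.AtPrime 𝔪) F)) n =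
      contactFiltration g' (bMax (algebraMap A (Localization.AtPrime 𝔪) F)) n := fun n =>
    JFlatEssSmooth.contactFiltration_eq_of_sub_unit_mul_mem_pow (hunit 0)
      (by rw [hcU 0, hz0, mul_comm, sub_self]; exact zero_mem _) n
  have hreachU : algebraMap A (Localization.AtPrime 𝔪) F ∈
      contactFiltration (algebraMap A (Localization.AtPrime 𝔪) (U 0)) (bMax (algebraMap A (Localization.AtPrime 𝔪) F))
        (bMax (algebraMap A (Localization.AtPrime 𝔪) F) * (adicOrder (algebraMap A (Localization.AtPrime 𝔪) F)).toNat) := by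
    rw [hcf]; exact hreach
  -- (3) the presentation of `J₃ᵗ` at `𝔪`
  have hc3 : ![algebraMap A (Localization.AtPrime 𝔪) (U 0), algebraMap A (Localization.AtPrime 𝔪) (U 1),
      algebraMap A (Localization.AtPrime 𝔪) (U 2)] = algebraMap A (Localization.AtPrime 𝔪) ∘ U := by
    funext i; fin_cases i <;> rfl
  have hgen3 : Ideal.span {algebraMap A (Localization.AtPrime 𝔪) (U 0), algebraMap A (Localization.AtPrime 𝔪) (U 1),
      algebraMap A (Localization.AtPrime 𝔪) (U 2)} = maximalIdeal (Localization.AtPrime 𝔪) := by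
    rw [← hspanU, range_fin_three]
  have hJ : ∀ m : ℕ, jFlatT (Localization.AtPrime 𝔪) (algebraMap A (Localization.AtPrime 𝔪) F) m =
      (weightedMonomialIdeal U ![bMax (algebraMap A (Localization.AtPrime 𝔪) F), 1, 1] m).map
        (algebraMap A (Localization.AtPrime 𝔪)) := by
    intro m
    rw [jFlatT_eq_jContact_of_eps_eq_one (Localization.AtPrime 𝔪) _ m htop hε,
      jContact_eq_contactFiltration (Localization.AtPrime 𝔪) hF0 hnm (hUmem 0) hU0sq hreachU m,
      CrossingPoint.map_weightedMonomialIdeal, ← hc3, CrossingPoint.weightedMonomialIdeal_eq_weightedIdealW,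
      JFlatEssSmooth.weightedIdealW_eq_contactFiltration _ _ _ hgen3 hB1 m]
  -- (4) the ι-side on a basic open, and `𝔪` isolated over `(U)`
  obtain ⟨h₁, hh₁, hiff⟩ := CrossingPoint.exists_stratumIff_crossing k₀ 𝔪 F hreg hdim hF0 hF2 htop hε
  obtain ⟨h₂, hh₂, hU⟩ := CrossingPoint.exists_not_mem_forall_le (Ideal.span (Set.range U)) 𝔪 (by
    intro x hx hKx hx𝔪
    haveI := hx
    obtain ⟨hprime, hcomap⟩ := StratumIff.isPrime_map_and_comap_map_eq 𝔪 x hx𝔪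
    have hle : maximalIdeal (Localization.AtPrime 𝔪) ≤ x.map (algebraMap A (Localization.AtPrime 𝔪)) := by
      rw [← hspanU, Ideal.span_le]
      rintro _ ⟨i, rfl⟩
      exact Ideal.mem_map_of_mem _ (hKx (Ideal.subset_span ⟨i, rfl⟩))
    have heq : x.map (algebraMap A (Localization.AtPrime 𝔪)) = maximalIdeal (Localization.AtPrime 𝔪) :=
      le_antisymm (IsLocalRing.le_maximalIdeal hprime.ne_top) hle
    have h𝔪eq : Ideal.comap (algebraMap A (Localization.AtPrime 𝔪)) (maximalIdeal (Localization.AtPrime 𝔪)) = 𝔪 :=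
      IsLocalization.AtPrime.under_maximalIdeal (Localization.AtPrime 𝔪) 𝔪
    rw [← h𝔪eq, ← heq, hcomap])
  have hUq : ∀ (𝔮 : Ideal A) [𝔮.IsPrime], h₂ ∉ 𝔮 → ((∀ i, U i ∈ 𝔮) ↔ 𝔪 ≤ 𝔮) := fun 𝔮 _ hh₂𝔮 =>
    ⟨fun hall => hU 𝔮 hh₂𝔮 (Ideal.span_le.mpr (Set.range_subset_iff.mpr hall)), fun hle i => hle (hUmem𝔪 i)⟩
  -- (5) assemble the body
  refine ⟨h₁ * h₂, fun hmem => (Ideal.IsPrime.mem_or_mem inferInstance hmem).elim hh₁ hh₂, 3, U,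
    ![bMax (algebraMap A (Localization.AtPrime 𝔪) F), 1, 1], ?_, ⟨hUmem, hli⟩, fun 𝔮 _ hh𝔮 hdim𝔮 => ?_⟩
  · intro i
    fin_cases i
    · exact hB1
    · exact Nat.one_pos
    · exact Nat.one_pos
  · have hh₁𝔮 : h₁ ∉ 𝔮 := fun h => hh𝔮 (Ideal.mul_mem_right _ _ h)
    have hh₂𝔮 : h₂ ∉ 𝔮 := fun h => hh𝔮 (Ideal.mul_mem_left _ _ h)
    refine ⟨(hUq 𝔮 hh₂𝔮).trans (hiff 𝔮 hh₁𝔮 hdim𝔮), fun hall m => ?_⟩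
    have hle := (hUq 𝔮 hh₂𝔮).mp hall
    have heq : 𝔮 = 𝔪 := CrossingPoint.eq_of_le_of_ringKrullDim hle hdim hdim𝔮
    subst heq
    exact hJ m

end JOpenLE3

end Summit.ResolutionOfSingularities.ResolutionOfSingularities.Theorems

end
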